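import Mathlib.Analysis.InnerProductSpace.PiL2
import Mathlib.Analysis.InnerProductSpace.Projection.Reflection
import HarnessLib

/-!
# Stub Y1 `stub_squareTwist_isometry` for crux `MoebiusLimitExists` (stmt-CriticalPhenomena-1344), line `Sketch` v18
(THEOREM-ONLY, `--supports stmt-CriticalPhenomena-1344`)

**The square twist.**  There is a linear isometric isomorphism `R` of `ℝ³ = EuclideanSpace ℝ (Fin 3)`
with `R e₁ = e₂`, `R e₂ = -e₁`, `R e₀ = -e₀` (`eₖ = EuclideanSpace.single k 1`), i.e. the improper
rotation `(u₀, u₁, u₂) ↦ (-u₀, -u₂, u₁)`: the quarter turn about the `0`-axis composed with the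
reflection `u₀ ↦ -u₀`.  It is the symmetry of the horizontal square `(a e₁, a e₂, -a e₁, -a e₂)` used by
skeleton v18 to protect the order-`0` and order-`1` Taylor coefficients of the Ward defect.

Proof.  `R := neg ∘ swap₁₂ ∘ flip₁`, where `flip₁ = ((ℝ ∙ e₁)ᗮ).reflection` is the reflection in the
coordinate hyperplane `{u₁ = 0}` (`Submodule.reflection`; it negates `e₁` and fixes `e₀`, `e₂`),
`swap₁₂ = LinearIsometryEquiv.piLpCongrLeft 2 ℝ ℝ (Equiv.swap 1 2)` exchanges the coordinates `1`
and `2` (`eₖ ↦ e_{swap k}`), and `neg = LinearIsometryEquiv.neg ℝ`.  Then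
`R e₁ = -(swap₁₂ (-e₁)) = e₂`, `R e₂ = -(swap₁₂ e₂) = -e₁`, `R e₀ = -(swap₁₂ e₀) = -e₀`.

References: standard linear algebra (the hyperoctahedral group `B₃ ⊂ O(3)` of signed coordinate
permutations).  No definitions are introduced.
-/

noncomputable section

namespace Summit.CriticalPhenomena.Ising3DConformalLimit.MoebiusLimitExistsSketchV16

/-- The reflection of `ℝ^ι` in the coordinate hyperplane `{u | u_k = 0}` — the orthogonal complement of
the line spanned by the coordinate vector `e_k = EuclideanSpace.single k 1` — fixes every other
coordinate vector `e_j`, `j ≠ k` (because `⟪e_k, e_j⟫ = 0`). [folklore] -/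
theorem coordReflection_single_of_ne {ι : Type*} [Fintype ι] [DecidableEq ι] {j k : ι} (h : j ≠ k) :
    (ℝ ∙ EuclideanSpace.single k (1 : ℝ))ᗮ.reflection (EuclideanSpace.single j (1 : ℝ)) =
      EuclideanSpace.single j 1 := by
  apply Submodule.reflection_mem_subspace_eq_self
  rw [Submodule.mem_orthogonal_singleton_iff_inner_right, EuclideanSpace.inner_single_left]
  simp [h]

/-- **STUB Y1 `stub_squareTwist_isometry` (pure linear algebra).**  There is a linear isometric
isomorphism `R` of `EuclideanSpace ℝ (Fin 3)` with `R e₁ = e₂`, `R e₂ = -e₁` and `R e₀ = -e₀`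
(`eₖ = EuclideanSpace.single k 1`), namely the improper rotation `(u₀, u₁, u₂) ↦ (-u₀, -u₂, u₁)`,
realised as `neg ∘ swap₁₂ ∘ flip₁` with `flip₁` the reflection in the hyperplane `{u₁ = 0}`,
`swap₁₂` the coordinate exchange `1 ↔ 2` and `neg` the point reflection. [folklore] -/
theorem stub_squareTwist_isometry : ∃ R : EuclideanSpace ℝ (Fin 3) ≃ₗᵢ[ℝ] EuclideanSpace ℝ (Fin 3),
    R (EuclideanSpace.single 1 1) = EuclideanSpace.single 2 1 ∧
    R (EuclideanSpace.single 2 1) = -EuclideanSpace.single 1 1 ∧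
    R (EuclideanSpace.single 0 1) = -EuclideanSpace.single 0 1 := by
  refine ⟨((ℝ ∙ EuclideanSpace.single (1 : Fin 3) (1 : ℝ))ᗮ.reflection.trans
      (LinearIsometryEquiv.piLpCongrLeft 2 ℝ ℝ (Equiv.swap (1 : Fin 3) 2))).trans
      (LinearIsometryEquiv.neg ℝ), ?_, ?_, ?_⟩
  · -- `R e₁ = -(swap₁₂ (flip₁ e₁)) = -(swap₁₂ (-e₁)) = e₂`
    simp only [LinearIsometryEquiv.trans_apply, LinearIsometryEquiv.coe_neg]
    rw [Submodule.reflection_orthogonalComplement_singleton_eq_neg, map_neg,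
      EuclideanSpace.piLpCongrLeft_single, Equiv.swap_apply_left, neg_neg]
  · -- `R e₂ = -(swap₁₂ (flip₁ e₂)) = -(swap₁₂ e₂) = -e₁`
    simp only [LinearIsometryEquiv.trans_apply, LinearIsometryEquiv.coe_neg]
    rw [coordReflection_single_of_ne (show (2 : Fin 3) ≠ 1 by decide),
      EuclideanSpace.piLpCongrLeft_single, Equiv.swap_apply_right]
  · -- `R e₀ = -(swap₁₂ (flip₁ e₀)) = -(swap₁₂ e₀) = -e₀`
    simp only [LinearIsometryEquiv.trans_apply, LinearIsometryEquiv.coe_neg]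
    rw [coordReflection_single_of_ne (show (0 : Fin 3) ≠ 1 by decide),
      EuclideanSpace.piLpCongrLeft_single,
      Equiv.swap_apply_of_ne_of_ne (show (0 : Fin 3) ≠ 1 by decide) (show (0 : Fin 3) ≠ 2 by decide)]

end Summit.CriticalPhenomena.Ising3DConformalLimit.MoebiusLimitExistsSketchV16
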